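import Literature.MathematicalPhysics.QuantumFieldTheory.Balaban1983to89.B9Eq325QprimeStarLowerBoundZd
import Literature.MathematicalPhysics.QuantumFieldTheory.Balaban1983to89.B9Eq324DeltaPrimeUpperBoundZd

/-!
# `Balaban1983to89.B9Eq325QGGQCoerciveExplicitZd` — [Balaban1985BackgroundPropagators] (3.25) p. 394 ∕ Thm 3.11 p. 416 («the operators Δ′_a, G′, (Q′G′²Q′*)⁻¹ … are positive
# definite. This is obvious for the first three operators») IN QUANTITATIVE CURRENCY AT THE `ℤᵈ × 𝔸` CARRIER: an EXPLICIT coercivity constant for the third operator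
# `Q′G′(U₀)²Q′*` of (3.25), `c″ = ((Lᵈ)^{2m}·Θ²)⁻¹` with `Θ = 4d∕η² + Σ_{j≤m} a_j`: `c″·⟨φ, φ⟩_τ ≤ ⟨φ, Q′G′(U₀)²Q′*φ⟩_τ` on `L²(𝔅, ·)` under the block-geometry clause
# `LevelDisjoint L m Λ s`, at EVERY unitary background whose averaged transporters up to level `m` are unitary — NO compactness — and the bound
# `⟨cφ, cφ⟩_τ ≤ c″⁻²·⟨φ, φ⟩_τ` for `c = (Q′G′²Q′*)⁻¹`; readings on the class (1.7), at cube members (no hypothesis left but the transporters), and at `U₀ = 1`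

statement-level skeleton of published theorems with citation tags; proofs where landed; nothing here is a claim about the
Yang–Mills mass gap

`[Balaban1985BackgroundPropagators]` ("B9", CMP **99** (1985) 389–434) p. 394 (3.25) («Rf = (I − G′Q′*(Q′G′²Q′*)⁻¹Q′G′)f … We do not know yet if the operators in the above
formulas are well defined, e.g. if Δ′_a, Q′G′²Q′* are invertible. It will be proved later (Theorem 3.11)»); p. 416 Thm 3.11.  `[Balaban1984PropagatorsII]` ("[4]") (2.22) p. 226
(the form bounds); `[Balaban1985Averaging]` Prop. 2 p. 26 (unitarity of the averaged transporters); `[Balaban1985RegularSpaces]` (1.7) p. 77, (1.131) p. 99 (the cube members).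
The assembly is two lines: `⟨φ, φ⟩_τ ≤ (Lᵈ)^{2m}‖Q′*φ‖²_τ` (`B9Eq325QprimeStarLowerBoundZd.levForm_self_le_mul_formE_QprimeStar`, this seat g5) and `‖Q′*φ‖²_τ ≤ Θ²⟨φ, Q′G′²Q′*φ⟩_τ`
(`B9Eq324DeltaPrimeUpperBoundZd.formE_QprimeStar_le_sq_mul_levForm_qggq`, this seat g4).  PDF held: `paper:balaban1985-cmp99-background-propagators` pp. 394, 416 (re-read 2026-08-28).

CITATION HEADER (lean-in-tree rule).  Cell `pub-ymgap` (YM Track A, D-0062 ∕ D-0149), node N06 = [B9], width seat `pub-ymgap-dag-n06-w4` (g5), CLAIM-2 ∕ INTENT-2 (the Θ-half of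
CLAIM-1, split off while the farm rebuilt the olean of p626673).  Inputs BY NAME: g5 `B9Eq325QprimeStarLowerBoundZd` (`levForm_self_le_mul_formE_QprimeStar`), g4
`B9Eq324DeltaPrimeUpperBoundZd` (`formE_QprimeStar_le_sq_mul_levForm_qggq`), g4 `B9Thm311InverseL2BoundsZd.levForm_cZd_self_le_of_coercive`, g2 `B9Eq325QGGQInvZd` (`levSupp`,
`levForm`, `qggq`, `cZd`), g2 `B9Eq325QprimeSingleSiteZd` (`LevelDisjoint`, `qprimeStarInjective_of_levelDisjoint`), dag-n06-b's `B9Thm311PosDefNearFlatZd.bgT_mem_unitaryUnits_of_reg17UnivP`,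
dag-n05-c's `B8CubeMemberLevelDisjoint.levelDisjoint_of_subset_cubeLamS`, `B9Thm311PosDefOpenZd.cubeMember_Ω0_finite`, `B8Eq119TwistedAxial.bgT_one`.

WHAT IS PROVED (kernel, 0 sorry; theorems only — no `def`, `instance`, `notation`; faithful Hermitian tracial `τ` a PARAMETER).
* §1 `theta_pos` (`Θ > 0`), `c2_pos` (`c″ > 0`), ★★★ `coercive_levForm_qggq_explicit` (`c″·⟨φ, φ⟩_τ ≤ ⟨φ, Q′G′(U₀)²Q′*φ⟩_τ`, every unitary `U₀` with unitary averaged transporters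
  up to level `m`, under `LevelDisjoint` — STATION 2's `hco` of dag-n06-w2's Combes–Thomas road with an EXPLICIT constant, replacing g4's compactness constant
  `B9Eq325QGGQCoerciveCompactZd.exists_coercive_levForm_qggq_plaqClosed` wherever explicitness matters), ★★ `levForm_cZd_self_le_explicit` (`⟨cφ, cφ⟩_τ ≤ c″⁻²·⟨φ, φ⟩_τ`).
* §2 (readings) `coercive_levForm_qggq_explicit_of_reg17UnivP` (class (1.7) below `α_Q∕L²`, `L ≥ 2`, `d > 0`), ★★ `coercive_levForm_qggq_explicit_cubeMember` (cube members of
  (1.131): NO geometric hypothesis displayed, `1 ≤ L ≤ ρ`, `m ≤ k`), `coercive_levForm_qggq_explicit_one_cubeMember` (A6: `U₀ = 1`).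

HONEST SCOPE.  `c″` depends on `η` (as `η⁴` through `Θ²`), on `Σ a_j` and on `(Lᵈ)^{2m}` — EXPLICIT but NOT uniform in the member (print's uniform Thm 3.11 constants are NOT
claimed); `L²_τ` currency, no decay; count-neutral helper (`--supports` the K1 item of record); N05 ∕ N06 NOT discharged; K1 NOT closed; one finite `𝕋⁴` programme at fixed
`ε`, Bałaban as printed; R4 closes only the conditional finite-`𝕋⁴` rung `BalabanLadder.UV` — nothing continuum ∕ ℝ⁴ ∕ OS ∕ mass gap ∕ Clay.  Unit `pub-ymgap-dag-n06-w4` (g5), 2026-08-28.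
-/

noncomputable section

namespace Literature.MathematicalPhysics.QuantumFieldTheory.Balaban1983to89.B9Eq325QGGQCoerciveExplicitZd

open B7Prop1Explicit
open B7Prop2Explicit (unitaryUnits)
open B8Eq119TwistedAxial (bgT bgT_one)
open B8Eq131CubesAdmissible (cubeFam)
open B8CubeMemberZd (cubeLamS)
open B8LeafModelZd (ZdIdx)
open B8Eq191FlatLettersCubeMember (cubeLamS_finite)
open B9Eq325QGGQInvZd (levSupp levForm qggq cZd)
open B9Eq325QprimeSingleSiteZd (LevelDisjoint qprimeStarInjective_of_levelDisjoint)
open B9Eq325QprimeStarLowerBoundZd (levForm_self_le_mul_formE_QprimeStar)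
open B9Eq324DeltaPrimeUpperBoundZd (formE_QprimeStar_le_sq_mul_levForm_qggq)
open B9Thm311InverseL2BoundsZd (levForm_cZd_self_le_of_coercive)
open B9Eq316AveragingTransposeZd (Reg17 alphaQ)
open B9Thm311PosDefNearFlatZd (bgT_mem_unitaryUnits_of_reg17UnivP)
open B9Thm311PosDefOpenZd (cubeMember_Ω0_finite)
open B8CubeMemberLevelDisjoint (levelDisjoint_of_subset_cubeLamS)

-- `Site` alone could resolve to the torus sites of `Setup.lean`; re-export the `ℤ^d` sites of `B7Prop1Explicit`.
export B7Prop1Explicit (Site)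

variable {d : ℕ} {𝔸 : Type*} [CStarAlgebra 𝔸]
variable (τ : 𝔸 →ₗ[ℂ] ℂ) (hτp : ∀ a : 𝔸, a ≠ 0 → 0 < (τ (star a * a)).re)
  (hτt : ∀ a b : 𝔸, τ (a * b) = τ (b * a)) (hτs : ∀ a : 𝔸, τ (star a) = starRingEnd ℂ (τ a))

/-! ## §1  The explicit coercivity constant `c″ = ((Lᵈ)^{2m}Θ²)⁻¹` for `Q′G′(U₀)²Q′*` and the bound for its inverse -/

section Explicit

variable [FiniteDimensional ℝ 𝔸] {L : ℕ} [NeZero L] {η : ℝ}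

/-- `Θ = 4d·η⁻² + Σ_{j≤m} a_j > 0` for `0 < d`, `η ≠ 0`, `a ≥ 0`. [cite: Balaban1985BackgroundPropagators, (3.23)–(3.24) p.394 (bookkeeping)] -/
theorem theta_pos (hd : 0 < d) (hη : η ≠ 0) (m : ℕ) {a : ℕ → ℝ} (ha : ∀ j, 0 ≤ a j) :
    0 < 4 * (d : ℝ) * (η ^ 2)⁻¹ + ∑ j ∈ Finset.range (m + 1), a j := by
  have h1 : (0 : ℝ) < 4 * (d : ℝ) * (η ^ 2)⁻¹ := by
    have hd' : (0 : ℝ) < d := by exact_mod_cast hd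
    have hη2 : (0 : ℝ) < η ^ 2 := by positivity
    positivity
  have h2 : (0 : ℝ) ≤ ∑ j ∈ Finset.range (m + 1), a j := Finset.sum_nonneg fun j _ => ha j
  linarith

/-- **`c″ = ((Lᵈ)^{2m}·Θ²)⁻¹ > 0`** (`L ≠ 0`, `0 < d`, `η ≠ 0`, `a ≥ 0`). [cite: Balaban1985BackgroundPropagators, Thm 3.11 p.416 (bookkeeping)] -/
theorem c2_pos (hd : 0 < d) (hη : η ≠ 0) (m : ℕ) {a : ℕ → ℝ} (ha : ∀ j, 0 ≤ a j) :
    0 < ((((L : ℝ) ^ d) ^ m) ^ 2 * (4 * (d : ℝ) * (η ^ 2)⁻¹ + ∑ j ∈ Finset.range (m + 1), a j) ^ 2)⁻¹ := by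
  have hL0 : (0 : ℝ) < (L : ℝ) := by exact_mod_cast Nat.pos_of_ne_zero (NeZero.ne L)
  have hΘ := theta_pos hd hη m ha
  positivity

include hτt hτs in
/-- ★★★ **THE EXPLICIT COERCIVITY OF `Q′G′(U₀)²Q′*`**: `c″·⟨φ, φ⟩_τ ≤ ⟨φ, Q′G′(U₀)²Q′*φ⟩_τ` for all `φ ∈ L²(𝔅, ·)`, `c″ = ((Lᵈ)^{2m}·Θ²)⁻¹`, `Θ = 4d·η⁻² + Σ_{j≤m} a_j`, at EVERY
unitary background `U₀` whose averaged transporters up to level `m` are unitary, under `LevelDisjoint L m Λ s` (`0 < d`, `η ≠ 0`, `a ≥ 0`): §4 and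
`B9Eq324DeltaPrimeUpperBoundZd.formE_QprimeStar_le_sq_mul_levForm_qggq` (`‖Q′*φ‖²_τ ≤ Θ²⟨φ, Q′G′²Q′*φ⟩_τ`) — STATION 2's `hco` with NO compactness.
[cite: Balaban1985BackgroundPropagators, Thm 3.11 p.416, (3.25) p.394, (3.18)–(3.19) p.393; Balaban1984PropagatorsII, (2.22) p.226; Balaban1985Averaging, Prop. 2 p.26] -/
theorem coercive_levForm_qggq_explicit (hd : 0 < d) (hη : η ≠ 0) {U₀ : Site d → Fin d → 𝔸ˣ} (hU : ∀ (x : Site d) (κ : Fin d), U₀ x κ ∈ unitaryUnits 𝔸)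
    (m : ℕ) {a : ℕ → ℝ} (ha : ∀ j, 0 ≤ a j) (Λ : ℕ → Finset (Site d)) {s : Finset (Site d)}
    (hT : ∀ j, j ≤ m → ∀ (z y : Site d), bgT L U₀ j z y ∈ unitaryUnits 𝔸) (h : LevelDisjoint L m Λ s) (φ : levSupp (𝔸 := 𝔸) m Λ) :
    ((((L : ℝ) ^ d) ^ m) ^ 2 * (4 * (d : ℝ) * (η ^ 2)⁻¹ + ∑ j ∈ Finset.range (m + 1), a j) ^ 2)⁻¹ * levForm τ m Λ φ φ ≤
      levForm τ m Λ φ (qggq L U₀ η τ hτp m a Λ s hd hη hτt hτs hU ha φ) := by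
  have h1 := levForm_self_le_mul_formE_QprimeStar τ hτp hτt hτs U₀ m Λ s (fun j' hj' => hT j' hj'.le) h φ
  have h2 := formE_QprimeStar_le_sq_mul_levForm_qggq τ hτp hτt hτs hd hη hU m ha Λ (s := s) hT φ
  have hL0 : (0 : ℝ) < (L : ℝ) := by exact_mod_cast Nat.pos_of_ne_zero (NeZero.ne L)
  have hA : (0 : ℝ) ≤ (((L : ℝ) ^ d) ^ m) ^ 2 := by positivity
  have hpos : (0 : ℝ) < (((L : ℝ) ^ d) ^ m) ^ 2 * (4 * (d : ℝ) * (η ^ 2)⁻¹ + ∑ j ∈ Finset.range (m + 1), a j) ^ 2 := by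
    have hΘ := theta_pos hd hη m ha
    positivity
  have h3 : levForm τ m Λ φ φ ≤ ((((L : ℝ) ^ d) ^ m) ^ 2 * (4 * (d : ℝ) * (η ^ 2)⁻¹ + ∑ j ∈ Finset.range (m + 1), a j) ^ 2) *
      levForm τ m Λ φ (qggq L U₀ η τ hτp m a Λ s hd hη hτt hτs hU ha φ) := by
    rw [mul_assoc]
    exact h1.trans (mul_le_mul_of_nonneg_left h2 hA)
  rw [inv_mul_le_iff₀ hpos]
  exact h3

include hτt hτs in
/-- ★★ **THE EXPLICIT BOUND FOR `(Q′G′²Q′*)⁻¹`**: `⟨cφ, cφ⟩_τ ≤ c″⁻²·⟨φ, φ⟩_τ` with `c = (Q′G′(U₀)²Q′*)⁻¹` (`B9Eq325QGGQInvZd.cZd`, available since `LevelDisjoint ⟹ Q′*`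
injective) and `c″ = ((Lᵈ)^{2m}·Θ²)⁻¹` — `B9Thm311InverseL2BoundsZd.levForm_cZd_self_le_of_coercive` fed with the explicit `hco`.
[cite: Balaban1985BackgroundPropagators, Thm 3.11 p.416, (3.25) p.394; Balaban1984PropagatorsII, (2.22) p.226] -/
theorem levForm_cZd_self_le_explicit (hd : 0 < d) (hη : η ≠ 0) {U₀ : Site d → Fin d → 𝔸ˣ} (hU : ∀ (x : Site d) (κ : Fin d), U₀ x κ ∈ unitaryUnits 𝔸)
    (m : ℕ) {a : ℕ → ℝ} (ha : ∀ j, 0 ≤ a j) (Λ : ℕ → Finset (Site d)) (s : Finset (Site d))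
    (hT : ∀ j, j ≤ m → ∀ (z y : Site d), bgT L U₀ j z y ∈ unitaryUnits 𝔸) (h : LevelDisjoint L m Λ s) (φ : levSupp (𝔸 := 𝔸) m Λ) :
    levForm τ m Λ (cZd L U₀ η τ hτp m a Λ s hd hη hτt hτs hU ha (qprimeStarInjective_of_levelDisjoint U₀ τ hτp hτs h) φ)
        (cZd L U₀ η τ hτp m a Λ s hd hη hτt hτs hU ha (qprimeStarInjective_of_levelDisjoint U₀ τ hτp hτs h) φ) ≤
      (((((L : ℝ) ^ d) ^ m) ^ 2 * (4 * (d : ℝ) * (η ^ 2)⁻¹ + ∑ j ∈ Finset.range (m + 1), a j) ^ 2)⁻¹)⁻¹ ^ 2 * levForm τ m Λ φ φ :=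
  levForm_cZd_self_le_of_coercive τ hτp hτt hτs hd hη m ha Λ s hU (qprimeStarInjective_of_levelDisjoint U₀ τ hτp hτs h) (c2_pos hd hη m ha)
    (fun ψ => coercive_levForm_qggq_explicit τ hτp hτt hτs hd hη hU m ha Λ hT h ψ) φ

end Explicit

/-! ## §2  Readings: the class (1.7) on `ℤᵈ`; cube members; the flat background -/

section Readings

variable [FiniteDimensional ℝ 𝔸] [Nontrivial 𝔸] {L : ℕ} [NeZero L] {η : ℝ}

include hτt hτs in
/-- ★★ **ON THE CLASS (1.7)**: the explicit coercivity `c″·⟨φ, φ⟩_τ ≤ ⟨φ, Q′G′(U₀)²Q′*φ⟩_τ`, `c″ = ((Lᵈ)^{2m}Θ²)⁻¹`, under `LevelDisjoint`, with no displayed transporter hypothesis.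
[cite: Balaban1985BackgroundPropagators, Thm 3.11 p.416, (3.25) p.394; Balaban1985Averaging, Prop. 2 p.26; Balaban1985RegularSpaces, (1.7) p.77] -/
theorem coercive_levForm_qggq_explicit_of_reg17UnivP (hd : 0 < d) (hL : 2 ≤ L) (hη : η ≠ 0) (m : ℕ) {a : ℕ → ℝ} (ha : ∀ j, 0 ≤ a j)
    (Λ : ℕ → Finset (Site d)) {s : Finset (Site d)} {U₀ : Site d → Fin d → 𝔸ˣ} (hU : ∀ (x : Site d) (κ : Fin d), U₀ x κ ∈ unitaryUnits 𝔸)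
    (hreg : Reg17 L m (fun _ => (Set.univ : Set (Site d))) (alphaQ d L / (L : ℝ) ^ 2) U₀) (h : LevelDisjoint L m Λ s) (φ : levSupp (𝔸 := 𝔸) m Λ) :
    ((((L : ℝ) ^ d) ^ m) ^ 2 * (4 * (d : ℝ) * (η ^ 2)⁻¹ + ∑ j ∈ Finset.range (m + 1), a j) ^ 2)⁻¹ * levForm τ m Λ φ φ ≤
      levForm τ m Λ φ (qggq L U₀ η τ hτp m a Λ s hd hη hτt hτs hU ha φ) :=
  coercive_levForm_qggq_explicit τ hτp hτt hτs hd hη hU m ha Λ (bgT_mem_unitaryUnits_of_reg17UnivP hd hL m hU hreg) h φ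

omit [Nontrivial 𝔸] in
include hτt hτs in
/-- ★★ **AT A CUBE MEMBER, NO GEOMETRIC HYPOTHESIS IS LEFT**: with `Λ_j` the truncated constraint classes `cubeLamS` of the cube tower of [Balaban1985RegularSpaces] (1.131)
and `s = □₀ = i.Ω 0`, the clause `LevelDisjoint` is dag-n05-c's `levelDisjoint_of_subset_cubeLamS` (`1 ≤ L ≤ ρ`, `m ≤ k`), so for EVERY unitary `U₀` whose averaged transporters
up to level `m` are unitary: `c″·⟨φ, φ⟩_τ ≤ ⟨φ, Q′G′(U₀)²Q′*φ⟩_τ` with the EXPLICIT `c″ = ((Lᵈ)^{2m}Θ²)⁻¹`, `Θ = 4d·(i.η)⁻² + Σ_{j≤m} a_j` — ONE constant for the whole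
closed class, member-dependent only through `m`, `i.η`, `Σ a_j`. [cite: Balaban1985BackgroundPropagators, Thm 3.11 p.416, (3.25) p.394, (3.18)–(3.19) p.393; Balaban1985RegularSpaces, (1.131) p.99] -/
theorem coercive_levForm_qggq_explicit_cubeMember (hd : 0 < d) {a₀ : ℕ → ℝ} (ha : ∀ j, 0 ≤ a₀ j)
    (i : ZdIdx d L) (hη : i.η ≠ 0) {a : Site d} {Mc ρ : ℕ} (hΩ : i.Ω = cubeFam false L a Mc ρ i.k) (hρ : L ≤ ρ) {m : ℕ} (hm : m ≤ i.k)
    (U₀ : Site d → Fin d → 𝔸ˣ) (hU₀ : ∀ x κ, U₀ x κ ∈ unitaryUnits 𝔸) (hT : ∀ j, j ≤ m → ∀ (z y : Site d), bgT L U₀ j z y ∈ unitaryUnits 𝔸)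
    (φ : levSupp (𝔸 := 𝔸) m (fun j => (cubeLamS_finite L a Mc ρ i.k m j).toFinset)) :
    ((((L : ℝ) ^ d) ^ m) ^ 2 * (4 * (d : ℝ) * (i.η ^ 2)⁻¹ + ∑ j ∈ Finset.range (m + 1), a₀ j) ^ 2)⁻¹ *
        levForm τ m (fun j => (cubeLamS_finite L a Mc ρ i.k m j).toFinset) φ φ ≤
      levForm τ m (fun j => (cubeLamS_finite L a Mc ρ i.k m j).toFinset) φ
        (qggq L U₀ i.η τ hτp m a₀ (fun j => (cubeLamS_finite L a Mc ρ i.k m j).toFinset) (cubeMember_Ω0_finite i hΩ).toFinset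
          hd hη hτt hτs hU₀ ha φ) := by
  have hL1 : 1 ≤ L := Nat.one_le_iff_ne_zero.2 (NeZero.ne L)
  have hs : cubeFam false L a Mc ρ i.k 0 ⊆ ↑((cubeMember_Ω0_finite i hΩ).toFinset) := by
    rw [Set.Finite.coe_toFinset, hΩ]
  have hΛ : ∀ j, j ≤ m → ∀ y ∈ (cubeLamS_finite L a Mc ρ i.k m j).toFinset, y ∈ cubeLamS L a Mc ρ i.k m j :=
    fun j _ y hy => (Set.Finite.mem_toFinset _).1 hy
  exact coercive_levForm_qggq_explicit τ hτp hτt hτs hd hη hU₀ m ha _ hT (levelDisjoint_of_subset_cubeLamS hL1 a Mc hρ hm hΛ hs) φ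

omit [Nontrivial 𝔸] in
include hτt hτs in
/-- **A6 ∕ NON-VACUITY AT THE CUBE MEMBER — THE FLAT BACKGROUND** (`U₀ = 1`: all transporters are `1`): the explicit coercivity holds at `U₀ = 1`.
[cite: Balaban1985BackgroundPropagators, Thm 3.11 p.416; Balaban1984PropagatorsII, (2.22) p.226; Balaban1985RegularSpaces, (1.131) p.99] -/
theorem coercive_levForm_qggq_explicit_one_cubeMember (hd : 0 < d) {a₀ : ℕ → ℝ} (ha : ∀ j, 0 ≤ a₀ j)
    (i : ZdIdx d L) (hη : i.η ≠ 0) {a : Site d} {Mc ρ : ℕ} (hΩ : i.Ω = cubeFam false L a Mc ρ i.k) (hρ : L ≤ ρ) {m : ℕ} (hm : m ≤ i.k)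
    (h1 : ∀ (x : Site d) (κ : Fin d), (1 : Site d → Fin d → 𝔸ˣ) x κ ∈ unitaryUnits 𝔸)
    (φ : levSupp (𝔸 := 𝔸) m (fun j => (cubeLamS_finite L a Mc ρ i.k m j).toFinset)) :
    ((((L : ℝ) ^ d) ^ m) ^ 2 * (4 * (d : ℝ) * (i.η ^ 2)⁻¹ + ∑ j ∈ Finset.range (m + 1), a₀ j) ^ 2)⁻¹ *
        levForm τ m (fun j => (cubeLamS_finite L a Mc ρ i.k m j).toFinset) φ φ ≤
      levForm τ m (fun j => (cubeLamS_finite L a Mc ρ i.k m j).toFinset) φ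
        (qggq L (1 : Site d → Fin d → 𝔸ˣ) i.η τ hτp m a₀ (fun j => (cubeLamS_finite L a Mc ρ i.k m j).toFinset) (cubeMember_Ω0_finite i hΩ).toFinset
          hd hη hτt hτs h1 ha φ) :=
  coercive_levForm_qggq_explicit_cubeMember τ hτp hτt hτs hd ha i hη hΩ hρ hm 1 h1
    (fun j _ z y => show bgT L (1 : Site d → Fin d → 𝔸ˣ) j z y ∈ unitaryUnits 𝔸 by rw [bgT_one]; exact (unitaryUnits 𝔸).one_mem) φ

end Readings

end Literature.MathematicalPhysics.QuantumFieldTheory.Balaban1983to89.B9Eq325QGGQCoerciveExplicitZd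

end
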